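import Summits.AtomisticToContinuum.HydrodynamicLimit.Theorems.JParityClosureLocalSecondLawEquilibriumDefs
import Literature.MathematicalPhysics.KineticTheory.HardSphereUniformGas

/-!
# Equilibrium stub `eq_energyMoment`: the second moment of the coarse kinetic energy (lead c3)

Equilibrium side-composition of line `exact-entropy-ledger-three-passivities` for the crux `JParityClosure.LocalSecondLaw`
(stmt-AtomisticToContinuum-13081).  Under the homogeneous local Gibbs law, at every field point and for every `N`,
`E[e_r(x)²] ≤ (B/2)² · E_γ‖v‖⁴` with `B = 3/(πr³)` and `γ = N(ū, Θ𝟙)`: pointwise `0 ≤ e_r ≤ (B/2)(N+1)⁻¹∑‖vᵢ‖²` (cone weights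
in `[0, B]`), Cauchy–Schwarz `((N+1)⁻¹∑aᵢ)² ≤ (N+1)⁻¹∑aᵢ²`, the rung-0 disintegration (`localGibbsMeasure_rung0_eq_map`) and
the Maxwellian one-particle velocity marginal (`measurePreserving_eval`), and the finite Gaussian fourth moment
(`IsGaussian.memLp_id`).

References: H. Spohn, *Large Scale Dynamics of Interacting Particles* (1991), Part I §2.3 (homogeneous Gibbs law).
-/

noncomputable section

namespace Summit.AtomisticToContinuum.HydrodynamicLimit.Theorems.LocalSecondLawEquilibrium

open scoped BigOperators Topology Classical MeasureTheory ENNReal InnerProductSpace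
open Filter Set MeasureTheory ProbabilityTheory
open Literature.MathematicalPhysics.KineticTheory
open Literature.Analysis.FluidPDE
open Summit.AtomisticToContinuum.HydrodynamicLimit.Theorems.LocalSecondLawNegative
open Summit.AtomisticToContinuum.HydrodynamicLimit.Theorems.LocalSecondLawLedger

namespace EnergyMoment

variable {N : ℕ}

/-- Pointwise: `e_r(x)² ≤ (B/2)² (N+1)⁻¹ ∑ᵢ ‖vᵢ‖⁴` (cone weights in `[0, B]`, then Cauchy–Schwarz). -/
theorem kinC_sq_le {r : ℝ} (hr : 0 < r) (w : Phase N) (x : T3) :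
    kinC r w x ^ 2 ≤ (3 / (Real.pi * r ^ 3) / 2) ^ 2 * (((N + 1 : ℕ) : ℝ)⁻¹ * ∑ i, ‖(w i).2‖ ^ 4) := by
  have hn : (0 : ℝ) < ((N + 1 : ℕ) : ℝ) := by positivity
  have hB : 0 ≤ 3 / (Real.pi * r ^ 3) := by positivity
  have hk0 : 0 ≤ kinC r w x := kinC_nonneg hr w x
  have hk1 : kinC r w x ≤ 3 / (Real.pi * r ^ 3) / 2 * (((N + 1 : ℕ) : ℝ)⁻¹ * ∑ i, ‖(w i).2‖ ^ 2) := by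
    rw [kinC_eq_sum, Finset.mul_sum, Finset.mul_sum, Finset.mul_sum]
    refine Finset.sum_le_sum fun i _ => ?_
    have hb := cone_le_const hr (w i).1 x
    have hb0 := cone_nonneg hr (w i).1 x
    have hv : 0 ≤ ‖(w i).2‖ ^ 2 := sq_nonneg _
    calc ((N + 1 : ℕ) : ℝ)⁻¹ * (cone r (w i).1 x * (‖(w i).2‖ ^ 2 / 2))
        ≤ ((N + 1 : ℕ) : ℝ)⁻¹ * (3 / (Real.pi * r ^ 3) * (‖(w i).2‖ ^ 2 / 2)) := by
          refine mul_le_mul_of_nonneg_left (mul_le_mul_of_nonneg_right hb (by positivity)) (by positivity)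
      _ = 3 / (Real.pi * r ^ 3) / 2 * (((N + 1 : ℕ) : ℝ)⁻¹ * ‖(w i).2‖ ^ 2) := by ring
  have hcs : (∑ i, ‖(w i).2‖ ^ 2) ^ 2 ≤ ((N + 1 : ℕ) : ℝ) * ∑ i, ‖(w i).2‖ ^ 4 := by
    have h := sq_sum_le_card_mul_sum_sq (s := (Finset.univ : Finset (Fin (N + 1)))) (f := fun i => ‖(w i).2‖ ^ 2)
    simp only [Finset.card_univ, Fintype.card_fin] at h
    calc (∑ i, ‖(w i).2‖ ^ 2) ^ 2 ≤ ((N + 1 : ℕ) : ℝ) * ∑ i, (‖(w i).2‖ ^ 2) ^ 2 := by exact_mod_cast h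
      _ = ((N + 1 : ℕ) : ℝ) * ∑ i, ‖(w i).2‖ ^ 4 := by
          congr 1; exact Finset.sum_congr rfl fun i _ => by ring
  calc kinC r w x ^ 2 ≤ (3 / (Real.pi * r ^ 3) / 2 * (((N + 1 : ℕ) : ℝ)⁻¹ * ∑ i, ‖(w i).2‖ ^ 2)) ^ 2 :=
        pow_le_pow_left₀ hk0 hk1 2
    _ = (3 / (Real.pi * r ^ 3) / 2) ^ 2 * (((N + 1 : ℕ) : ℝ)⁻¹ ^ 2 * (∑ i, ‖(w i).2‖ ^ 2) ^ 2) := by ring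
    _ ≤ (3 / (Real.pi * r ^ 3) / 2) ^ 2 * (((N + 1 : ℕ) : ℝ)⁻¹ ^ 2 * (((N + 1 : ℕ) : ℝ) * ∑ i, ‖(w i).2‖ ^ 4)) :=
        mul_le_mul_of_nonneg_left (mul_le_mul_of_nonneg_left hcs (by positivity)) (by positivity)
    _ = _ := by field_simp

/-- **Velocity observables of one particle**: under the homogeneous law `E[g(vᵢ)] = ∫ g dγ`, `γ = N(ū, Θ𝟙)`. -/
theorem lintegral_lawC_vel {σ a Θ : ℝ} (ū : V3) (ha : 0 < a) (hΘ : 0 < Θ) (hσhalf : σ ≤ 1 / 2) (N : ℕ) (Φ : Flow σ N)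
    (i : Fin (N + 1)) {g : V3 → ℝ≥0∞} (hg : Measurable g) :
    ∫⁻ w, g (w i).2 ∂(lawC σ a Θ ū N Φ) = ∫⁻ v, g v ∂(gaussMeasure ū Θ) := by
  haveI : IsProbabilityMeasure (posGibbsMeasure (fun _ : T3 => a) (hsDiameter σ N) (N + 1)) :=
    isProbabilityMeasure_posGibbsMeasure continuous_const (fun _ => ha) hσhalf N
  have hF : Measurable fun w : Phase N => g (w i).2 := hg.comp (measurable_pi_apply i).snd
  change ∫⁻ w, g (w i).2 ∂(localGibbsLaw σ (fun _ => a) (fun _ => ū) (fun _ => Θ) N Φ) = _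
  rw [localGibbsLaw_eq, localGibbsMeasure_rung0_eq_map σ ha.le hΘ ū N, lintegral_map hF measurable_zipConfig,
    lintegral_prod (fun p => g ((zipConfig p) i).2) (hF.comp measurable_zipConfig).aemeasurable]
  have hinner : ∀ xs : Fin (N + 1) → T3,
      ∫⁻ vs, g ((zipConfig (xs, vs)) i).2 ∂(Measure.pi fun _ : Fin (N + 1) => gaussMeasure ū Θ) =
        ∫⁻ v, g v ∂(gaussMeasure ū Θ) := by
    intro xs
    have h := (measurePreserving_eval (fun _ : Fin (N + 1) => gaussMeasure ū Θ) i).lintegral_comp hg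
    simpa only [zipConfig_apply, Function.eval] using h
  simp_rw [hinner]
  rw [lintegral_const, measure_univ, mul_one]

end EnergyMoment

/-- **Registered stub `eq_energyMoment`** (line `exact-entropy-ledger-three-passivities`, equilibrium side composition; lead c3):
the coarse kinetic energy has a bounded second moment under the homogeneous law, uniformly in `N`, the flow and the field
point: `E[e_r(x)²] ≤ (B/2)²·E_γ‖v‖⁴`. -/
theorem eq_energyMoment : ∀ (a Θ σ r : ℝ) (ū : V3), 0 < a → 0 < Θ → 0 < σ → σ ≤ 1 / 2 → 0 < r → ∃ C : ℝ, 0 ≤ C ∧ ∀ (N : ℕ) (Φ : Flow σ N) (x : T3), ∫⁻ w, ENNReal.ofReal (kinC r w x ^ 2) ∂(lawC σ a Θ ū N Φ) ≤ ENNReal.ofReal C := by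
  intro a Θ σ r ū ha hΘ _hσ hσhalf hr
  set B2 : ℝ := (3 / (Real.pi * r ^ 3) / 2) ^ 2 with hB2
  have hB2 : 0 ≤ B2 := by positivity
  -- the Gaussian fourth moment
  set M : ℝ≥0∞ := ∫⁻ v, ENNReal.ofReal (‖v‖ ^ 4) ∂(gaussMeasure ū Θ) with hM
  have hint : Integrable (fun v : V3 => ‖v‖ ^ 4) (gaussMeasure ū Θ) :=
    (IsGaussian.memLp_id (gaussMeasure ū Θ) 4 (by simp)).integrable_norm_pow (by norm_num)
  have hMtop : M ≠ ∞ := by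
    have h := hint.hasFiniteIntegral
    rw [hasFiniteIntegral_iff_ofReal (Eventually.of_forall fun v => by positivity)] at h
    exact h.ne
  refine ⟨B2 * M.toReal, by positivity, fun N Φ x => ?_⟩
  have hn : (0 : ℝ) < ((N + 1 : ℕ) : ℝ) := by positivity
  -- pointwise bound, then integrate
  have hpt : ∀ w : Phase N, ENNReal.ofReal (kinC r w x ^ 2) ≤
      ENNReal.ofReal B2 * (ENNReal.ofReal (((N + 1 : ℕ) : ℝ)⁻¹) * ∑ i, ENNReal.ofReal (‖(w i).2‖ ^ 4)) := by
    intro w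
    rw [← ENNReal.ofReal_sum_of_nonneg (fun i _ => by positivity), ← ENNReal.ofReal_mul (by positivity),
      ← ENNReal.ofReal_mul hB2]
    exact ENNReal.ofReal_le_ofReal (EnergyMoment.kinC_sq_le hr w x)
  have hmeas : ∀ i : Fin (N + 1), Measurable fun w : Phase N => ENNReal.ofReal (‖(w i).2‖ ^ 4) := fun i =>
    ((measurable_pi_apply i).snd.norm.pow_const 4).ennreal_ofReal
  have hterm : ∀ i : Fin (N + 1), ∫⁻ w, ENNReal.ofReal (‖(w i).2‖ ^ 4) ∂(lawC σ a Θ ū N Φ) = M := fun i =>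
    EnergyMoment.lintegral_lawC_vel ū ha hΘ hσhalf N Φ i (measurable_norm.pow_const 4).ennreal_ofReal
  calc ∫⁻ w, ENNReal.ofReal (kinC r w x ^ 2) ∂(lawC σ a Θ ū N Φ)
      ≤ ∫⁻ w, ENNReal.ofReal B2 * (ENNReal.ofReal (((N + 1 : ℕ) : ℝ)⁻¹) * ∑ i, ENNReal.ofReal (‖(w i).2‖ ^ 4))
          ∂(lawC σ a Θ ū N Φ) := lintegral_mono hpt
    _ = ENNReal.ofReal B2 * (ENNReal.ofReal (((N + 1 : ℕ) : ℝ)⁻¹) *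
          ∑ i, ∫⁻ w, ENNReal.ofReal (‖(w i).2‖ ^ 4) ∂(lawC σ a Θ ū N Φ)) := by
        rw [lintegral_const_mul' _ _ ENNReal.ofReal_ne_top, lintegral_const_mul' _ _ ENNReal.ofReal_ne_top,
          lintegral_finsetSum _ fun i _ => hmeas i]
    _ = ENNReal.ofReal B2 * M := by
        simp only [hterm, Finset.sum_const, Finset.card_univ, Fintype.card_fin, nsmul_eq_mul]
        rw [← ENNReal.ofReal_natCast]
        rw [show ENNReal.ofReal B2 * (ENNReal.ofReal (((N + 1 : ℕ) : ℝ)⁻¹) * (ENNReal.ofReal ((N + 1 : ℕ) : ℝ) * M)) =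
            ENNReal.ofReal (B2 * ((((N + 1 : ℕ) : ℝ)⁻¹) * ((N + 1 : ℕ) : ℝ))) * M by
              rw [ENNReal.ofReal_mul hB2, ENNReal.ofReal_mul (by positivity)]; ring]
        rw [inv_mul_cancel₀ hn.ne', mul_one]
    _ = ENNReal.ofReal (B2 * M.toReal) := by
        rw [ENNReal.ofReal_mul hB2, ENNReal.ofReal_toReal hMtop]

end Summit.AtomisticToContinuum.HydrodynamicLimit.Theorems.LocalSecondLawEquilibrium

end
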